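import Summits.QuantumFields.YangMills.Theorems.BalabanUVNodesN15KingModelCurvatureDecay
import Summits.QuantumFields.YangMills.Theorems.BalabanUVNodesN15KingModelComplexLinkNumericalRange
import HarnessLib

/-!
# BalabanUVNodes ∕ N15 — THE KING-MODEL RUNG (PART Ϧ-a): THE WEIGHT-CONJUGATION ENGINE — an abstract, covariant, OPERATOR-NORM Combes–Thomas layer on `T × 𝕜ⁿ`:
# `wtConj φ T = e^{φ}Te^{−φ}`, the non-Hermitian Lax–Milgram bound, and «conjugated coercivity ⟹ exponentially decaying inverse» for ANY matrix, in three currencies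
# (fibre blocks, entries, and Dimock's bilinear block-to-block form)
# (Track A, DAG node N15 = NE2; FAN-OUT v1.1 §N15 s3 «KING-MODEL RUNG … + what the curved case adds»; count-neutral)

HONEST FRAMING.  Count-neutral (cell `pub-ymgap`, seat `pub-ymgap-dag-n15-e` g50; `--supports stmt-QuantumFields-27247 --as helper` = K3ᴬ, KEY MAP v3).  Elementary finite-dimensional
linear algebra on King's carrier `Tor K × n` (one finite torus, fibre `𝕜ⁿ`, `𝕜 = ℝ` or `ℂ`); the Combes–Thomas (1973) mechanism in the quadratic-form version of the tree's real engines
(`King1986.UniformDecay` §1 for real SYMMETRIC matrices via `QGQInverse.conj`; `Beta.CombesThomasForm.combesThomas_form`) and of PART Ϳ-g (`…CurvatureDecay`, covariant but for the FINE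
covariance `−cΔ_U+m²` only), now for an ARBITRARY matrix and an ARBITRARY real weight, with the conclusion as an OPERATOR-NORM bound on the conjugated inverse — the currency in which
products of kernels (sandwiches `Q(U)G(U)Q(U)^*`, resolvent differences) keep `η`-uniform constants.  PART Ϧ-b supplies the two defect estimates (fine Laplacian, covariant block term),
PART Ϧ-c the decay of King's ∕ Bałaban's full background propagator `G(U) = (−cΔ_U + m² + aQ(U)^*Q(U))⁻¹` at every link field.  NOT Bałaban's multi-level `G_k(U)` nor his random-walk
expansion [Balaban1985BackgroundPropagators] (3.47)–(3.55); NOT the short-distance `L^∞` bounds (3.46) ∕ King's Props 3.8–3.9; NOT a node discharge (N15 of record untouched); nothing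
continuum ∕ ℝ⁴ ∕ OS ∕ Clay.

THE RESULTS (`K` any period vector, fibre `𝕜ⁿ`, `T` ANY matrix on `Tor K × n`, `φ : Tor K → ℝ` ANY weight; `‖·‖` = the `ℓ²` operator norm, `blk T x y` = the `n × n` fibre block):
* §1 `ℓ²` bookkeeping: `norm_fib_le_norm`, def `siteVec` (a fibre vector placed at one site), `fib_mulVec_siteVec`, ★ `norm_blk_le_opNorm`
  (`‖blk T x y‖ ≤ ‖T‖`), `norm_entry_le_norm_blk`, `norm_entry_le_opNorm`.
* §2 THE NON-HERMITIAN LAX–MILGRAM BOUND: `γΣ‖v_x‖² ≤ Re⟨v,Tv⟩` (all `v`, `γ > 0`) ⟹ `isUnit_of_reCoercive`, `norm_le_of_reCoercive` (`γ‖v‖ ≤ ‖Tv‖`), ★★ `l2_opNorm_inv_le_of_reCoercive`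
  (`‖T⁻¹‖ ≤ γ⁻¹`) — PART Ϡ-i's Hermitian `l2_opNorm_inv_le_of_coercive'` without Hermiticity (the conjugated operators below are not Hermitian).
* §3 THE CONJUGATION: def `wtConj φ T = e^{φ}Te^{−φ}` (`(e^{φ(x)−φ(y)})T((x,i),(y,j))`); `wtConj_add∕sub∕smul∕one∕mul` (an algebra automorphism), `wtConj_neg_wtConj`, `wtConj_inv`,
  `isUnit_of_isUnit_wtConj`, ★ `wtConj_mulVec` (`= e^{φ}(T(e^{−φ}v))`, Ϳ-g `expWt`), ★ `star_dotProduct_wtConj_mulVec` (`⟨ω, T_φω⟩ = ⟨e^{φ}ω, T e^{−φ}ω⟩` — the conjugated FORM of Ϳ-g),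
  `blk_wtConj`, `norm_blk_wtConj` (`‖blk T_φ x y‖ = e^{φ(x)−φ(y)}‖blk T x y‖`).
* §4 ★★★ ABSTRACT COMBES–THOMAS: if the conjugated form is coercive, `γΣ‖ω_x‖² ≤ Re⟨ω, T_φω⟩` (all `ω`, `γ > 0`), then `T` is invertible and
  ★★★ `l2_opNorm_wtConj_inv_le` (`‖e^{φ}T⁻¹e^{−φ}‖ ≤ γ⁻¹`), ★★★ `norm_blk_inv_le_of_conjCoercive` (`‖blk T⁻¹ x y‖ ≤ γ⁻¹e^{−(φ(x)−φ(y))}` — every fibre block, no factor of the fibre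
  dimension), `norm_inv_entry_le_of_conjCoercive`, and ★★★ `norm_star_dotProduct_inv_mulVec_le` — DIMOCK's LEMMA 30 IN ABSTRACT COVARIANT FORM: `|⟨f, T⁻¹g⟩| ≤ γ⁻¹‖e^{−φ}f‖‖e^{φ}g‖`.
WHY OPERATOR NORMS (honest): an `ℓ²` Combes–Thomas bound sees `1∕γ` per entry, not the true short-distance size of a lattice Green's function; what it delivers UNIFORMLY is the RATE and
every quantity with a natural `ℓ²` normalisation (fibre blocks of `G(U)`, the sandwich `Q(U)G(U)Q(U)^*`, King's `Δ_eff(U)`, resolvent differences) — PART Ϧ-c∕Ϧ-e.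
PRIOR TREE ART (by name, not restated): Ϳ-g (`expWt`, `wt_neg_wt`, `norm_wt_apply`), Ͱ-b (`fib`, `fib_apply`, `norm_apply_le_norm_fib`), Ͱ-f (`sum_norm_fib_sq`, `re_star_dotProduct_le_norm_mul_norm`), Ϛ-n (`norm_star_dotProduct_le`, Cauchy–Schwarz),
`LatticeDiamagneticInequality.blk`, Mathlib (`Matrix.l2_opNorm_mulVec`, `Matrix.cstar_norm_def`, `Matrix.toEuclideanCLM_toLp`, `Matrix.mulVec_injective_iff_isUnit`, `Matrix.inv_eq_right_inv`,
`EuclideanSpace.inner_toLp_toLp`).  Dedup (rg at filing): basename 0 files; needles `wtConj|siteVec|conjCoercive|reCoercive` 0 files in `Summits/QuantumFields` + `Literature/MathematicalPhysics`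
(`Literature/Analysis/FluidPDE`'s `expConj` is a different object and FQN).  Locators: Combes–Thomas mechanism as in the tree's `Beta.CombesThomasForm` header [CombesThomas1973, §II] (folklore);
[Dimock2013] App. D Lemma 30 (usher1.5) `|⟨f,G_k(Ω)f′⟩| = |⟨e_qf,[e_{−q}G_ke_q]e_{−q}f′⟩| ≤ O(1)‖e_qf‖‖e_{−q}f′‖` (the bilinear currency); [Balaban1985BackgroundPropagators] (3.39)∕(3.46) p.397–398
(shape of the decay statements only); [King1986] (4.33)–(4.34) p.674 (shape).  0 `sorry`, 2 `def`.
-/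

noncomputable section
open scoped BigOperators ComplexConjugate ComplexOrder InnerProductSpace Matrix.Norms.L2Operator
open Finset Matrix WithLp

namespace Summit.QuantumFields.YangMills.BalabanUVNodes.N15KingModelRung.CombesThomas

open Literature.MathematicalPhysics.QuantumFieldTheory.LatticeDiamagneticInequality (blk)
open Literature.MathematicalPhysics.QuantumFieldTheory.Balaban1983to89.B5Prop11Plancherel (Tor)
open Summit.QuantumFields.YangMills.BalabanUVNodes.N15KingModelRung.Covariant (fib fib_apply norm_apply_le_norm_fib sum_norm_fib_sq re_star_dotProduct_le_norm_mul_norm norm_star_dotProduct_le)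
open Summit.QuantumFields.YangMills.BalabanUVNodes.N15KingModelRung.Curvature (expWt wt_neg_wt norm_wt_apply)

variable {d : ℕ} (K : Fin (d + 1) → ℕ) [hK : ∀ μ, NeZero (K μ)]
variable {𝕜 : Type*} [RCLike 𝕜] {n : Type*} [Fintype n] [DecidableEq n]

/-! ## §1 `ℓ²` bookkeeping on `T × 𝕜ⁿ`: fibres, blocks, entries versus the operator norm -/

section L2

omit [DecidableEq n] in
/-- A fibre norm is bounded by the total `ℓ²` norm: `‖v_x‖ ≤ ‖v‖`. [folklore] -/
theorem norm_fib_le_norm (v : Tor K × n → 𝕜) (x : Tor K) : ‖fib K v x‖ ≤ ‖(toLp 2 v : EuclideanSpace 𝕜 (Tor K × n))‖ := by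
  have h : ‖fib K v x‖ ^ 2 ≤ ‖(toLp 2 v : EuclideanSpace 𝕜 (Tor K × n))‖ ^ 2 := by
    rw [← sum_norm_fib_sq]; exact Finset.single_le_sum (fun z _ => sq_nonneg ‖fib K v z‖) (Finset.mem_univ x)
  exact (abs_le_of_sq_le_sq' h (norm_nonneg _)).2

/-- A FIBRE VECTOR PLACED AT ONE SITE: `siteVec y w = δ_y ⊗ w`. [folklore] -/
def siteVec (y : Tor K) (w : n → 𝕜) : Tor K × n → 𝕜 := fun q => if q.1 = y then w q.2 else 0

omit hK [Fintype n] [DecidableEq n] in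
/-- Its fibres: `w` at `y`, `0` elsewhere. [folklore] -/
theorem fib_siteVec (y : Tor K) (w : n → 𝕜) (z : Tor K) : fib K (siteVec K y w) z = if z = y then (toLp 2 w : EuclideanSpace 𝕜 n) else 0 := by
  ext i
  by_cases h : z = y
  · rw [if_pos h, fib_apply, siteVec, if_pos h]
  · rw [if_neg h, fib_apply, siteVec, if_neg h]; rfl

omit [DecidableEq n] in
/-- `‖δ_y ⊗ w‖ = ‖w‖`. [folklore] -/
theorem norm_siteVec (y : Tor K) (w : n → 𝕜) : ‖(toLp 2 (siteVec K y w) : EuclideanSpace 𝕜 (Tor K × n))‖ = ‖(toLp 2 w : EuclideanSpace 𝕜 n)‖ := by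
  have h : ‖(toLp 2 (siteVec K y w) : EuclideanSpace 𝕜 (Tor K × n))‖ ^ 2 = ‖(toLp 2 w : EuclideanSpace 𝕜 n)‖ ^ 2 := by
    rw [← sum_norm_fib_sq, Finset.sum_eq_single y]
    · rw [fib_siteVec, if_pos rfl]
    · intro z _ hz; rw [fib_siteVec, if_neg hz, norm_zero]; ring
    · intro hy; exact absurd (Finset.mem_univ y) hy
  exact (sq_eq_sq₀ (norm_nonneg _) (norm_nonneg _)).mp h

omit [DecidableEq n] in
/-- `T(δ_y ⊗ w)` read at the fibre `x` is the fibre block applied to `w`: `(T(δ_y⊗w))_x = (blk T x y)w`. [folklore] -/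
theorem fib_mulVec_siteVec (T : Matrix (Tor K × n) (Tor K × n) 𝕜) (y : Tor K) (w : n → 𝕜) (x : Tor K) :
    fib K (T *ᵥ siteVec K y w) x = (toLp 2 (blk T x y *ᵥ w) : EuclideanSpace 𝕜 n) := by
  ext i
  rw [fib_apply, PiLp.toLp_apply, Matrix.mulVec, Matrix.mulVec, dotProduct, dotProduct, Fintype.sum_prod_type, Finset.sum_eq_single y]
  · simp only [siteVec, if_true, blk, Matrix.of_apply]
  · intro z _ hz; exact Finset.sum_eq_zero fun j _ => by simp only [siteVec, if_neg hz, mul_zero]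
  · intro hy; exact absurd (Finset.mem_univ y) hy

/-- ★ A FIBRE BLOCK IS BOUNDED BY THE WHOLE OPERATOR: `‖blk T x y‖ ≤ ‖T‖` (`ℓ²` operator norms). [folklore] -/
theorem norm_blk_le_opNorm (T : Matrix (Tor K × n) (Tor K × n) 𝕜) (x y : Tor K) : ‖blk T x y‖ ≤ ‖T‖ := by
  rw [Matrix.cstar_norm_def (A := blk T x y)]
  refine ContinuousLinearMap.opNorm_le_bound _ (norm_nonneg _) fun w => ?_
  have hw : w = toLp 2 (ofLp w) := rfl
  rw [hw, Matrix.toEuclideanCLM_toLp, ← fib_mulVec_siteVec]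
  calc ‖fib K (T *ᵥ siteVec K y (ofLp w)) x‖ ≤ ‖(toLp 2 (T *ᵥ siteVec K y (ofLp w)) : EuclideanSpace 𝕜 (Tor K × n))‖ := norm_fib_le_norm K _ x
    _ ≤ ‖T‖ * ‖(toLp 2 (siteVec K y (ofLp w)) : EuclideanSpace 𝕜 (Tor K × n))‖ :=
        Matrix.l2_opNorm_mulVec T (toLp 2 (siteVec K y (ofLp w)) : EuclideanSpace 𝕜 (Tor K × n))
    _ = ‖T‖ * ‖(toLp 2 (ofLp w) : EuclideanSpace 𝕜 n)‖ := by rw [norm_siteVec]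

/-- An entry is bounded by its fibre block: `|A i j| ≤ ‖A‖` for `A : 𝕜^{n×n}`. [folklore] -/
theorem norm_entry_le_norm_blk (A : Matrix n n 𝕜) (i j : n) : ‖A i j‖ ≤ ‖A‖ := by
  have h1 : A i j = (A *ᵥ Pi.single j 1) i := by rw [Matrix.mulVec_single_one]; rfl
  have h2 : ‖(toLp 2 (Pi.single j (1 : 𝕜)) : EuclideanSpace 𝕜 n)‖ = 1 := by
    rw [show (toLp 2 (Pi.single j (1 : 𝕜)) : EuclideanSpace 𝕜 n) = EuclideanSpace.single j (1 : 𝕜) from rfl, PiLp.norm_single, norm_one]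
  calc ‖A i j‖ = ‖(A *ᵥ Pi.single j 1) i‖ := by rw [h1]
    _ ≤ ‖(toLp 2 (A *ᵥ Pi.single j 1) : EuclideanSpace 𝕜 n)‖ := PiLp.norm_apply_le (toLp 2 (A *ᵥ Pi.single j (1 : 𝕜)) : EuclideanSpace 𝕜 n) i
    _ ≤ ‖A‖ * ‖(toLp 2 (Pi.single j (1 : 𝕜)) : EuclideanSpace 𝕜 n)‖ := Matrix.l2_opNorm_mulVec A (toLp 2 (Pi.single j (1 : 𝕜)) : EuclideanSpace 𝕜 n)
    _ = ‖A‖ := by rw [h2, mul_one]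

/-- `|T((x,i),(y,j))| ≤ ‖T‖`. [folklore] -/
theorem norm_entry_le_opNorm (T : Matrix (Tor K × n) (Tor K × n) 𝕜) (x y : Tor K) (i j : n) : ‖T (x, i) (y, j)‖ ≤ ‖T‖ :=
  (norm_entry_le_norm_blk (blk T x y) i j).trans (norm_blk_le_opNorm K T x y)

end L2

/-! ## §2 The non-Hermitian Lax–Milgram bound -/

section LaxMilgram

/-- A `Re`-coercive matrix is injective, hence invertible (any matrix, Hermitian or not). [folklore] -/
theorem isUnit_of_reCoercive {T : Matrix (Tor K × n) (Tor K × n) 𝕜} {γ : ℝ} (hγ : 0 < γ)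
    (hcoer : ∀ v : Tor K × n → 𝕜, γ * ∑ x, ‖fib K v x‖ ^ 2 ≤ RCLike.re (star v ⬝ᵥ (T *ᵥ v))) : IsUnit T := by
  refine Matrix.mulVec_injective_iff_isUnit.mp fun v w hvw => ?_
  have h0 : T *ᵥ (v - w) = 0 := by rw [Matrix.mulVec_sub, hvw, sub_self]
  have h := hcoer (v - w)
  rw [h0, dotProduct_zero, map_zero] at h
  have hsum : ∑ x, ‖fib K (v - w) x‖ ^ 2 = 0 :=
    le_antisymm (by nlinarith [Finset.sum_nonneg fun x (_ : x ∈ Finset.univ) => sq_nonneg ‖fib K (v - w) x‖]) (Finset.sum_nonneg fun _ _ => sq_nonneg _)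
  rw [sum_norm_fib_sq, sq_eq_zero_iff, norm_eq_zero] at hsum
  have : v - w = 0 := by simpa using congrArg ofLp hsum
  exact sub_eq_zero.mp this

omit [DecidableEq n] in
/-- `Re`-coercivity bounds vectors by their images: `γ‖v‖ ≤ ‖Tv‖`. [folklore] -/
theorem norm_le_of_reCoercive {T : Matrix (Tor K × n) (Tor K × n) 𝕜} {γ : ℝ}
    (hcoer : ∀ v : Tor K × n → 𝕜, γ * ∑ x, ‖fib K v x‖ ^ 2 ≤ RCLike.re (star v ⬝ᵥ (T *ᵥ v))) (v : Tor K × n → 𝕜) :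
    γ * ‖(toLp 2 v : EuclideanSpace 𝕜 (Tor K × n))‖ ≤ ‖(toLp 2 (T *ᵥ v) : EuclideanSpace 𝕜 (Tor K × n))‖ := by
  set N := ‖(toLp 2 v : EuclideanSpace 𝕜 (Tor K × n))‖ with hN
  have h := hcoer v
  rw [sum_norm_fib_sq] at h
  have h2 : RCLike.re (star v ⬝ᵥ (T *ᵥ v)) ≤ N * ‖(toLp 2 (T *ᵥ v) : EuclideanSpace 𝕜 (Tor K × n))‖ := re_star_dotProduct_le_norm_mul_norm K v _
  by_cases hz : N = 0
  · rw [hz, mul_zero]; exact norm_nonneg _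
  · have hpos : 0 < N := lt_of_le_of_ne (norm_nonneg _) (Ne.symm hz)
    nlinarith

/-- ★★ **THE LAX–MILGRAM BOUND**: `γΣ‖v_x‖² ≤ Re⟨v,Tv⟩` for all `v` (`γ > 0`) ⟹ `‖T⁻¹‖ ≤ γ⁻¹`, for ANY matrix. [folklore] -/
theorem l2_opNorm_inv_le_of_reCoercive {T : Matrix (Tor K × n) (Tor K × n) 𝕜} {γ : ℝ} (hγ : 0 < γ)
    (hcoer : ∀ v : Tor K × n → 𝕜, γ * ∑ x, ‖fib K v x‖ ^ 2 ≤ RCLike.re (star v ⬝ᵥ (T *ᵥ v))) : ‖T⁻¹‖ ≤ γ⁻¹ := by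
  have hdet : IsUnit T.det := (Matrix.isUnit_iff_isUnit_det _).mp (isUnit_of_reCoercive K hγ hcoer)
  rw [Matrix.cstar_norm_def]
  refine ContinuousLinearMap.opNorm_le_bound _ (inv_nonneg.2 hγ.le) fun w' => ?_
  have hw' : w' = toLp 2 (ofLp w') := rfl
  rw [hw', Matrix.toEuclideanCLM_toLp]
  set v := T⁻¹ *ᵥ ofLp w' with hv
  have hTv : T *ᵥ v = ofLp w' := by rw [hv, Matrix.mulVec_mulVec, Matrix.mul_nonsing_inv _ hdet, Matrix.one_mulVec]
  have h := norm_le_of_reCoercive K hcoer v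
  rw [hTv] at h
  rw [le_inv_mul_iff₀ hγ]
  exact h

end LaxMilgram

/-! ## §3 The weight conjugation `T ↦ e^{φ}Te^{−φ}` -/

section Conj

/-- THE WEIGHT-CONJUGATED MATRIX `T_φ := e^{φ}Te^{−φ}`: `T_φ((x,i),(y,j)) = e^{φ(x)−φ(y)}·T((x,i),(y,j))` (real weight, constant on fibres; Dimock's `e_{−q}[…]e_q`, the tree's `QGQInverse.conj`
for real matrices). [cite: Dimock2013, App. D, proof of Lemma 30] -/
def wtConj (φ : Tor K → ℝ) (T : Matrix (Tor K × n) (Tor K × n) 𝕜) : Matrix (Tor K × n) (Tor K × n) 𝕜 := fun p q => ((Real.exp (φ p.1 - φ q.1) : ℝ) : 𝕜) * T p q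

omit hK [Fintype n] [DecidableEq n] in
/-- Entries of `T_φ`. [folklore] -/
@[simp] theorem wtConj_apply (φ : Tor K → ℝ) (T : Matrix (Tor K × n) (Tor K × n) 𝕜) (p q : Tor K × n) : wtConj K φ T p q = ((Real.exp (φ p.1 - φ q.1) : ℝ) : 𝕜) * T p q := rfl

omit hK [Fintype n] [DecidableEq n] in
/-- Additive. [folklore] -/
theorem wtConj_add (φ : Tor K → ℝ) (S T : Matrix (Tor K × n) (Tor K × n) 𝕜) : wtConj K φ (S + T) = wtConj K φ S + wtConj K φ T := by
  ext p q; simp only [wtConj_apply, Matrix.add_apply, mul_add]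

omit hK [Fintype n] [DecidableEq n] in
/-- Subtractive. [folklore] -/
theorem wtConj_sub (φ : Tor K → ℝ) (S T : Matrix (Tor K × n) (Tor K × n) 𝕜) : wtConj K φ (S - T) = wtConj K φ S - wtConj K φ T := by
  ext p q; simp only [wtConj_apply, Matrix.sub_apply, mul_sub]

omit hK [Fintype n] [DecidableEq n] in
/-- Homogeneous. [folklore] -/
theorem wtConj_smul (φ : Tor K → ℝ) (r : 𝕜) (T : Matrix (Tor K × n) (Tor K × n) 𝕜) : wtConj K φ (r • T) = r • wtConj K φ T := by
  ext p q; simp only [wtConj_apply, Matrix.smul_apply, smul_eq_mul]; ring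

omit hK [Fintype n] in
/-- `1_φ = 1`. [folklore] -/
theorem wtConj_one (φ : Tor K → ℝ) : wtConj K φ (1 : Matrix (Tor K × n) (Tor K × n) 𝕜) = 1 := by
  ext p q
  by_cases h : p = q
  · subst h; rw [wtConj_apply, Matrix.one_apply_eq, sub_self, Real.exp_zero, RCLike.ofReal_one, one_mul]
  · rw [wtConj_apply, Matrix.one_apply_ne h, mul_zero]

omit [DecidableEq n] in
/-- MULTIPLICATIVE: `(ST)_φ = S_φT_φ` (the inner weights cancel). [folklore] -/
theorem wtConj_mul (φ : Tor K → ℝ) (S T : Matrix (Tor K × n) (Tor K × n) 𝕜) : wtConj K φ (S * T) = wtConj K φ S * wtConj K φ T := by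
  ext p q
  simp only [wtConj_apply, Matrix.mul_apply, Finset.mul_sum]
  refine Finset.sum_congr rfl fun r _ => ?_
  have h : Real.exp (φ p.1 - φ q.1) = Real.exp (φ p.1 - φ r.1) * Real.exp (φ r.1 - φ q.1) := by rw [← Real.exp_add]; ring_nf
  rw [h, RCLike.ofReal_mul]; ring

omit hK [Fintype n] [DecidableEq n] in
/-- The opposite weight undoes the conjugation: `(T_φ)_{−φ} = T`. [folklore] -/
theorem wtConj_neg_wtConj (φ : Tor K → ℝ) (T : Matrix (Tor K × n) (Tor K × n) 𝕜) : wtConj K (fun x => -φ x) (wtConj K φ T) = T := by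
  ext p q
  rw [wtConj_apply, wtConj_apply, ← mul_assoc, ← RCLike.ofReal_mul, ← Real.exp_add, show -φ p.1 - -φ q.1 + (φ p.1 - φ q.1) = 0 by ring, Real.exp_zero, RCLike.ofReal_one, one_mul]

/-- If `T_φ` is invertible then so is `T`. [folklore] -/
theorem isUnit_of_isUnit_wtConj (φ : Tor K → ℝ) {T : Matrix (Tor K × n) (Tor K × n) 𝕜} (h : IsUnit (wtConj K φ T)) : IsUnit T := by
  have hdet : IsUnit (wtConj K φ T).det := (Matrix.isUnit_iff_isUnit_det _).mp h
  have h1 : wtConj K (fun x => -φ x) (wtConj K φ T) * wtConj K (fun x => -φ x) (wtConj K φ T)⁻¹ = 1 := by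
    rw [← wtConj_mul, Matrix.mul_nonsing_inv _ hdet, wtConj_one]
  rw [wtConj_neg_wtConj] at h1
  exact IsUnit.of_mul_eq_one _ h1

/-- THE CONJUGATE OF THE INVERSE IS THE INVERSE OF THE CONJUGATE: `(T⁻¹)_φ = (T_φ)⁻¹` (`T` invertible). [folklore] -/
theorem wtConj_inv (φ : Tor K → ℝ) {T : Matrix (Tor K × n) (Tor K × n) 𝕜} (hT : IsUnit T) : wtConj K φ T⁻¹ = (wtConj K φ T)⁻¹ := by
  have hdet : IsUnit T.det := (Matrix.isUnit_iff_isUnit_det _).mp hT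
  have h1 : wtConj K φ T * wtConj K φ T⁻¹ = 1 := by rw [← wtConj_mul, Matrix.mul_nonsing_inv _ hdet, wtConj_one]
  exact (Matrix.inv_eq_right_inv h1).symm

omit [DecidableEq n] in
/-- ★ THE CONJUGATED MATRIX ACTS AS `e^{φ}T e^{−φ}`: `T_φ v = e^{φ}(T(e^{−φ}v))` (Ϳ-g `expWt`). [cite: Dimock2013, App. D, proof of Lemma 30] -/
theorem wtConj_mulVec (φ : Tor K → ℝ) (T : Matrix (Tor K × n) (Tor K × n) 𝕜) (v : Tor K × n → 𝕜) :
    wtConj K φ T *ᵥ v = expWt K φ (T *ᵥ expWt K (fun x => -φ x) v) := by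
  funext p
  simp only [Matrix.mulVec, dotProduct, wtConj, expWt, Finset.mul_sum]
  refine Finset.sum_congr rfl fun q _ => ?_
  rw [sub_eq_add_neg, Real.exp_add, RCLike.ofReal_mul]; ring

omit [DecidableEq n] in
/-- Real weights move across the pairing: `⟨f, e^{ψ}u⟩ = ⟨e^{ψ}f, u⟩`. [folklore] -/
theorem star_dotProduct_expWt (ψ : Tor K → ℝ) (f u : Tor K × n → 𝕜) : star f ⬝ᵥ expWt K ψ u = star (expWt K ψ f) ⬝ᵥ u := by
  simp only [dotProduct, Pi.star_apply, expWt, star_mul', RCLike.star_def, RCLike.conj_ofReal]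
  exact Finset.sum_congr rfl fun p _ => by ring

omit [DecidableEq n] in
/-- ★ THE CONJUGATED FORM: `⟨ω, T_φ ω⟩ = ⟨e^{φ}ω, T(e^{−φ}ω)⟩` — PART Ϳ-g's conjugated quadratic form is the plain form of `T_φ`. [cite: Dimock2013, App. D, proof of Lemma 30] -/
theorem star_dotProduct_wtConj_mulVec (φ : Tor K → ℝ) (T : Matrix (Tor K × n) (Tor K × n) 𝕜) (ω : Tor K × n → 𝕜) :
    star ω ⬝ᵥ (wtConj K φ T *ᵥ ω) = star (expWt K φ ω) ⬝ᵥ (T *ᵥ expWt K (fun x => -φ x) ω) := by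
  rw [wtConj_mulVec, star_dotProduct_expWt]

omit hK [Fintype n] [DecidableEq n] in
/-- Fibre blocks of the conjugate: `blk T_φ x y = e^{φ(x)−φ(y)}·blk T x y`. [folklore] -/
theorem blk_wtConj (φ : Tor K → ℝ) (T : Matrix (Tor K × n) (Tor K × n) 𝕜) (x y : Tor K) : blk (wtConj K φ T) x y = ((Real.exp (φ x - φ y) : ℝ) : 𝕜) • blk T x y := by
  ext i j; simp only [blk, Matrix.of_apply, wtConj_apply, Matrix.smul_apply, smul_eq_mul]

omit hK in
/-- `‖blk T_φ x y‖ = e^{φ(x)−φ(y)}‖blk T x y‖`. [folklore] -/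
theorem norm_blk_wtConj (φ : Tor K → ℝ) (T : Matrix (Tor K × n) (Tor K × n) 𝕜) (x y : Tor K) : ‖blk (wtConj K φ T) x y‖ = Real.exp (φ x - φ y) * ‖blk T x y‖ := by
  rw [blk_wtConj, norm_smul, RCLike.norm_ofReal, abs_of_pos (Real.exp_pos _)]

end Conj

/-! ## §4 Abstract Combes–Thomas: conjugated coercivity ⟹ an exponentially decaying inverse -/

section CT

variable {T : Matrix (Tor K × n) (Tor K × n) 𝕜} {φ : Tor K → ℝ} {γ : ℝ}

/-- A coercive conjugated form makes `T` invertible. [folklore] -/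
theorem isUnit_of_conjCoercive (hγ : 0 < γ) (hconj : ∀ ω : Tor K × n → 𝕜, γ * ∑ x, ‖fib K ω x‖ ^ 2 ≤ RCLike.re (star ω ⬝ᵥ (wtConj K φ T *ᵥ ω))) : IsUnit T :=
  isUnit_of_isUnit_wtConj K φ (isUnit_of_reCoercive K hγ hconj)

/-- ★★★ **THE CONJUGATED INVERSE IS BOUNDED**: `γΣ‖ω_x‖² ≤ Re⟨e^{φ}ω, T e^{−φ}ω⟩` for all `ω` (`γ > 0`) ⟹ `‖e^{φ}T⁻¹e^{−φ}‖ ≤ γ⁻¹` (Dimock's `‖𝒟_q⁻¹h‖ ≤ 2c₀⁻¹‖h‖`).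
[cite: Dimock2013, App. D, proof of Lemma 30] -/
theorem l2_opNorm_wtConj_inv_le (hγ : 0 < γ) (hconj : ∀ ω : Tor K × n → 𝕜, γ * ∑ x, ‖fib K ω x‖ ^ 2 ≤ RCLike.re (star ω ⬝ᵥ (wtConj K φ T *ᵥ ω))) :
    ‖wtConj K φ T⁻¹‖ ≤ γ⁻¹ := by
  rw [wtConj_inv K φ (isUnit_of_conjCoercive K hγ hconj)]
  exact l2_opNorm_inv_le_of_reCoercive K hγ hconj

/-- ★★★ **ABSTRACT COMBES–THOMAS, FIBRE-BLOCK CURRENCY**: under conjugated coercivity, `‖blk T⁻¹ x y‖ ≤ γ⁻¹·e^{−(φ(x)−φ(y))}` for all sites `x, y` — every `n × n` block of the inverse,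
with no factor of the fibre dimension. [cite: Dimock2013, App. D, Lemma 30; Balaban1985BackgroundPropagators, (3.39) p.397] -/
theorem norm_blk_inv_le_of_conjCoercive (hγ : 0 < γ) (hconj : ∀ ω : Tor K × n → 𝕜, γ * ∑ x, ‖fib K ω x‖ ^ 2 ≤ RCLike.re (star ω ⬝ᵥ (wtConj K φ T *ᵥ ω))) (x y : Tor K) :
    ‖blk T⁻¹ x y‖ ≤ γ⁻¹ * Real.exp (-(φ x - φ y)) := by
  have h1 : ‖blk (wtConj K φ T⁻¹) x y‖ ≤ γ⁻¹ := (norm_blk_le_opNorm K _ x y).trans (l2_opNorm_wtConj_inv_le K hγ hconj)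
  rw [norm_blk_wtConj] at h1
  have hE : 0 < Real.exp (φ x - φ y) := Real.exp_pos _
  calc ‖blk T⁻¹ x y‖ = Real.exp (-(φ x - φ y)) * (Real.exp (φ x - φ y) * ‖blk T⁻¹ x y‖) := by
        rw [← mul_assoc, ← Real.exp_add, neg_add_cancel, Real.exp_zero, one_mul]
    _ ≤ Real.exp (-(φ x - φ y)) * γ⁻¹ := mul_le_mul_of_nonneg_left h1 (Real.exp_nonneg _)
    _ = γ⁻¹ * Real.exp (-(φ x - φ y)) := mul_comm _ _

/-- The same for matrix entries: `|T⁻¹((x,i),(y,j))| ≤ γ⁻¹e^{−(φ(x)−φ(y))}`. [cite: Dimock2013, App. D, Lemma 30; King1986, (4.33) p.674] -/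
theorem norm_inv_entry_le_of_conjCoercive (hγ : 0 < γ) (hconj : ∀ ω : Tor K × n → 𝕜, γ * ∑ x, ‖fib K ω x‖ ^ 2 ≤ RCLike.re (star ω ⬝ᵥ (wtConj K φ T *ᵥ ω))) (x y : Tor K) (i j : n) :
    ‖T⁻¹ (x, i) (y, j)‖ ≤ γ⁻¹ * Real.exp (-(φ x - φ y)) :=
  (norm_entry_le_norm_blk (blk T⁻¹ x y) i j).trans (norm_blk_inv_le_of_conjCoercive K hγ hconj x y)

/-- ★★★ **DIMOCK's LEMMA 30 IN ABSTRACT COVARIANT FORM (the bilinear currency)**: under conjugated coercivity, for all fields `f, g`: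
`|⟨f, T⁻¹g⟩| ≤ γ⁻¹·‖e^{−φ}f‖·‖e^{φ}g‖` — «`|⟨f,G f′⟩| = |⟨e_qf,[e_{−q}Ge_q]e_{−q}f′⟩| ≤ O(1)‖e_qf‖‖e_{−q}f′‖`». [cite: Dimock2013, App. D, Lemma 30 (usher1.5)] -/
theorem norm_star_dotProduct_inv_mulVec_le (hγ : 0 < γ) (hconj : ∀ ω : Tor K × n → 𝕜, γ * ∑ x, ‖fib K ω x‖ ^ 2 ≤ RCLike.re (star ω ⬝ᵥ (wtConj K φ T *ᵥ ω)))
    (f g : Tor K × n → 𝕜) :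
    ‖star f ⬝ᵥ (T⁻¹ *ᵥ g)‖ ≤ γ⁻¹ * ‖(toLp 2 (expWt K (fun x => -φ x) f) : EuclideanSpace 𝕜 (Tor K × n))‖ * ‖(toLp 2 (expWt K φ g) : EuclideanSpace 𝕜 (Tor K × n))‖ := by
  -- `T⁻¹g = e^{−φ}·(T⁻¹)_φ(e^{φ}g)`
  have h1 : wtConj K φ T⁻¹ *ᵥ expWt K φ g = expWt K φ (T⁻¹ *ᵥ g) := by
    rw [wtConj_mulVec]
    have : expWt K (fun x => -φ x) (expWt K φ g) = g := wt_neg_wt K φ g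
    rw [this]
  have h2 : T⁻¹ *ᵥ g = expWt K (fun x => -φ x) (wtConj K φ T⁻¹ *ᵥ expWt K φ g) := by
    rw [h1]; exact (wt_neg_wt K φ _).symm
  rw [h2, star_dotProduct_expWt]
  calc ‖star (expWt K (fun x => -φ x) f) ⬝ᵥ (wtConj K φ T⁻¹ *ᵥ expWt K φ g)‖
      ≤ ‖(toLp 2 (expWt K (fun x => -φ x) f) : EuclideanSpace 𝕜 (Tor K × n))‖ * ‖(toLp 2 (wtConj K φ T⁻¹ *ᵥ expWt K φ g) : EuclideanSpace 𝕜 (Tor K × n))‖ :=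
        norm_star_dotProduct_le K _ _
    _ ≤ ‖(toLp 2 (expWt K (fun x => -φ x) f) : EuclideanSpace 𝕜 (Tor K × n))‖ * (‖wtConj K φ T⁻¹‖ * ‖(toLp 2 (expWt K φ g) : EuclideanSpace 𝕜 (Tor K × n))‖) :=
        mul_le_mul_of_nonneg_left (Matrix.l2_opNorm_mulVec (wtConj K φ T⁻¹) (toLp 2 (expWt K φ g) : EuclideanSpace 𝕜 (Tor K × n))) (norm_nonneg _)
    _ ≤ ‖(toLp 2 (expWt K (fun x => -φ x) f) : EuclideanSpace 𝕜 (Tor K × n))‖ * (γ⁻¹ * ‖(toLp 2 (expWt K φ g) : EuclideanSpace 𝕜 (Tor K × n))‖) :=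
        mul_le_mul_of_nonneg_left (mul_le_mul_of_nonneg_right (l2_opNorm_wtConj_inv_le K hγ hconj) (norm_nonneg _)) (norm_nonneg _)
    _ = _ := by ring

end CT

end Summit.QuantumFields.YangMills.BalabanUVNodes.N15KingModelRung.CombesThomas

end
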